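import Literature.Barriers.RiemannHypothesis.EpsteinZetaRealZerosSmallK
import HarnessLib

/-!
# No real zeros at all for `k ≤ 32/5`: the class-isolated Epstein argument reaches `d = 163`
# (`L(σ, χ₋₁₆₃) > 0` on `(0, 1)` in the kernel; extension of the generation-8 audit of `EpsteinZetaRealZeros`)

Continuation of `EpsteinZetaRealZerosSmallK.lean` (barrier audit of
`Literature.Barriers.RiemannHypothesis.EpsteinZetaRealZeros`, generation 8), which proves
`Re Λ_z(σ) < 0` on `(0, 1)` for `4/5 ≤ Im z ≤ 6` and hence `Re L(σ, χ) > 0` on `(0, 1)` for every odd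
real primitive character of conductor `4 < d ≤ 144`. The constant `6` there is where the cell
decomposition of its elementary inequality `smallK_keyIneq` stops, NOT where the method stops: at
`u → 0` the condition is `log y < 2 − 2/20 − β ≈ 1.899`, i.e. `y < 6.68`, against the sharp threshold
`log y < log 4π − γ`, `y < 7.0555` (Bateman–Grosswald (10)–(11)). This file pushes the same argument,
with the same ingredients (`Λ₀ < 1/20` on `(0, 2]`, the Bessel allowance `1/1000`, secant monotonicity
on cells), to **`y ≤ 32/5 = 6.4`** with seventeen finer cells (the tightest check is `1.99903 ≤ 2` on
`[1/5, 6/25]`; at `u → 0` the margin is `1.899 − log 6.4 = 0.043`):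

* `smallK_keyIneq_R4` — the elementary inequality for `6 ≤ y ≤ 32/5`;
* `re_thetaΛ_neg_of_six_le_im`, `re_thetaΛ_neg_of_im_le_thirtyTwo_fifths` — **for
  `4/5 ≤ y = Im z ≤ 32/5` and every `0 < σ < 1`, `Re Λ_z(σ) < 0`**;
* `re_neg_of_starkK_le_thirtyTwo_fifths`, `no_realZero_of_starkK_le_thirtyTwo_fifths` — for a positive
  definite real form with `4/5 ≤ k = √|d|/(2a) ≤ 32/5`, every continuation of `ζ_Q` is negative on
  `(0, 1)`; no real zero in `(0, 1)`;
* `re_neg_of_mem_reducedForms_of_le_onehundredsixtythree`,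
  **`LFunction_re_pos_of_odd_quadratic_of_le_onehundredsixtythree`**,
  **`LFunction_ne_zero_of_odd_quadratic_of_le_onehundredsixtythree`** — for `4 < d ≤ 163` EVERY reduced
  class of discriminant `−d` has `k ≤ √d/2 ≤ √163/2 = 6.3836 ≤ 32/5`, so the class-isolated sign
  argument goes through: `Re L(σ, χ) > 0` on ALL of `(0, 1)` for the odd real primitive character mod
  `d` — in particular for **`d = 163`** (class number one, `ζ_{ℚ(√−163)} = Z_{(1,1,41)}`, the deepest
  row of every prime-sum certificate table: Lu–Zaman–Zhao's certificate for `χ₋₁₆₃` needs the primes up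
  to `3.4·10⁷`), kernel-checked and unconditional.

The sharp constant `4πe^{−γ} = 7.0555…` (`d < 199.1` for the principal form) is NOT reached; `32/5`
is what the crude bound `Λ₀ < 1/20` affords with cells of width `≥ 1/50`.

## Proof

Identical to `EpsteinZetaRealZerosSmallK.lean` (see there): for `6 ≤ y ≤ 32/5`, `½ < σ < 1`,
`u = 2σ − 1`, the decomposition `Λ_z(σ) = 2y^σΛ(2σ) + 2y^{1−σ}Λ(2 − 2σ) + E_z(σ)`,
`|E_z(σ)| ≤ 48√y e^{−1.4πy} ≤ 2/1000` (`y ≥ 3`, `√y ≤ 2.53`, `e^{−4} < 1/49`), `Λ = Λ₀ − 1/s − 1/(1−s)`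
with `Re Λ₀ < 1/20` on `(0, 2]`, reduce `Re Λ_z(σ) < 0` to
`y^u(1/20 − 1/(1+u) + 1/u) + 1/1000 ≤ 1/(1−u) + 1/u − 1/20` (`smallK_keyIneq_R4`), proved on the cells
`[0,1/50], [1/50,1/25], [1/25,3/50], [3/50,2/25], [2/25,1/10], [1/10,3/25], [3/25,7/50], [7/50,17/100],
[17/100,1/5], [1/5,6/25], [6/25,7/25], [7/25,33/100], [33/100,2/5], [2/5,1/2], [1/2,13/20],
[13/20,47/50], [47/50,1]` by `smallK_cell` with certified bounds `(32/5)^{k/n} ≤ X` from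
`(32/5)^k ≤ X^n` (`rpow_le_of_pow_le`, `norm_num`). The rest (reflection `s ↦ 1 − s`, the point `½`
by Bateman–Grosswald (11), transfer to forms, the class sum continued by the identity theorem) is
verbatim.

## References

* [BatemanGrosswald1964] P. T. Bateman, E. Grosswald, *On Epstein's zeta function*, Acta Arith. 9
  (1964) 365–373, Theorem 3, (10)–(11).
* [Stark1967EpsteinZeros] H. M. Stark, *On the zeros of Epstein's zeta function*, Mathematika 14
  (1967) 47–55.
* [MontgomeryVaughan2007] H. L. Montgomery, R. C. Vaughan, *Multiplicative Number Theory I*, CUP 2007,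
  §10.1 (the completed zeta function), Corollary 11.12.
-/

noncomputable section

open Complex Filter Topology MeasureTheory Set HurwitzZeta
open scoped UpperHalfPlane

namespace Literature.Barriers.RiemannHypothesis

open Literature.NumberTheory.Automorphic
open Literature.NumberTheory.LFunctions.RealZeros

/-! ## The elementary inequality on `6 ≤ y ≤ 32/5` -/

/-- **Range `6 ≤ y ≤ 32/5`** (`β = 1/1000`; seventeen cells with endpoints
`0, 1/50, 1/25, 3/50, 2/25, 1/10, 3/25, 7/50, 17/100, 1/5, 6/25, 7/25, 33/100, 2/5, 1/2, 13/20, 47/50, 1`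
and certified upper bounds for `(32/5)^{k/n}`; the tightest check is `1.99903 ≤ 2` on `[1/5, 6/25]`, the
margin at `u → 0` is `1.9 − 1/1000 − log 6.4 ≈ 0.043`). [folklore] -/
private theorem smallK_keyIneq_R4 {y u : ℝ} (hy1 : 6 ≤ y) (hy2 : y ≤ 32 / 5) (hu0 : 0 < u) (hu1 : u < 1) :
    y ^ u * (1 / 20 - 1 / (1 + u) + 1 / u) + 1 / 1000 ≤ 1 / (1 - u) + 1 / u - 1 / 20 := by
  have hy1' : (1 : ℝ) ≤ y := by linarith
  have cell : ∀ (p q X : ℝ), (32 / 5 : ℝ) ^ q ≤ X → p ≤ u → u ≤ q →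
      (1 - p) * ((X - 1) / q + (1 + q) * (1 / 20 * (X + 1) + 1 / 1000)) ≤ 2 →
      y ^ u * (1 / 20 - 1 / (1 + u) + 1 / u) + 1 / 1000 ≤ 1 / (1 - u) + 1 / u - 1 / 20 :=
    fun p q X hX hp hq hc => smallK_cell hy1' hy2 hX hp hu0 hq hu1 (by norm_num) (by norm_num) hc
  rcases le_or_gt u (1/50) with h1 | h1
  · exact cell 0 (1/50) (12973/12500) (rpow_le_of_pow_le (k := 1) (n := 50) (by norm_num)
      (by norm_num) (by norm_num) (by norm_num) (by norm_num)) hu0.le h1 (by norm_num)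
  rcases le_or_gt u (1/25) with h2 | h2
  · exact cell (1/50) (1/25) (107709/100000) (rpow_le_of_pow_le (k := 1) (n := 25) (by norm_num)
      (by norm_num) (by norm_num) (by norm_num) (by norm_num)) h1.le h2 (by norm_num)
  rcases le_or_gt u (3/50) with h3 | h3
  · exact cell (1/25) (3/50) (111783/100000) (rpow_le_of_pow_le (k := 3) (n := 50) (by norm_num)
      (by norm_num) (by norm_num) (by norm_num) (by norm_num)) h2.le h3 (by norm_num)
  rcases le_or_gt u (2/25) with h4 | h4
  · exact cell (3/50) (2/25) (116011/100000) (rpow_le_of_pow_le (k := 2) (n := 25) (by norm_num)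
      (by norm_num) (by norm_num) (by norm_num) (by norm_num)) h3.le h4 (by norm_num)
  rcases le_or_gt u (1/10) with h5 | h5
  · exact cell (2/25) (1/10) (120399/100000) (rpow_le_of_pow_le (k := 1) (n := 10) (by norm_num)
      (by norm_num) (by norm_num) (by norm_num) (by norm_num)) h4.le h5 (by norm_num)
  rcases le_or_gt u (3/25) with h6 | h6
  · exact cell (1/10) (3/25) (124953/100000) (rpow_le_of_pow_le (k := 3) (n := 25) (by norm_num)
      (by norm_num) (by norm_num) (by norm_num) (by norm_num)) h5.le h6 (by norm_num)
  rcases le_or_gt u (7/50) with h7 | h7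
  · exact cell (3/25) (7/50) (129679/100000) (rpow_le_of_pow_le (k := 7) (n := 50) (by norm_num)
      (by norm_num) (by norm_num) (by norm_num) (by norm_num)) h6.le h7 (by norm_num)
  rcases le_or_gt u (17/100) with h8 | h8
  · exact cell (7/50) (17/100) (68553/50000) (rpow_le_of_pow_le (k := 17) (n := 100) (by norm_num)
      (by norm_num) (by norm_num) (by norm_num) (by norm_num)) h7.le h8 (by norm_num)
  rcases le_or_gt u (1/5) with h9 | h9
  · exact cell (17/100) (1/5) (144957/100000) (rpow_le_of_pow_le (k := 1) (n := 5) (by norm_num)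
      (by norm_num) (by norm_num) (by norm_num) (by norm_num)) h8.le h9 (by norm_num)
  rcases le_or_gt u (6/25) with h10 | h10
  · exact cell (1/5) (6/25) (15613/10000) (rpow_le_of_pow_le (k := 6) (n := 25) (by norm_num)
      (by norm_num) (by norm_num) (by norm_num) (by norm_num)) h9.le h10 (by norm_num)
  rcases le_or_gt u (7/25) with h11 | h11
  · exact cell (6/25) (7/25) (42041/25000) (rpow_le_of_pow_le (k := 7) (n := 25) (by norm_num)
      (by norm_num) (by norm_num) (by norm_num) (by norm_num)) h10.le h11 (by norm_num)
  rcases le_or_gt u (33/100) with h12 | h12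
  · exact cell (7/25) (33/100) (4613/2500) (rpow_le_of_pow_le (k := 33) (n := 100) (by norm_num)
      (by norm_num) (by norm_num) (by norm_num) (by norm_num)) h11.le h12 (by norm_num)
  rcases le_or_gt u (2/5) with h13 | h13
  · exact cell (33/100) (2/5) (52531/25000) (rpow_le_of_pow_le (k := 2) (n := 5) (by norm_num)
      (by norm_num) (by norm_num) (by norm_num) (by norm_num)) h12.le h13 (by norm_num)
  rcases le_or_gt u (1/2) with h14 | h14
  · exact cell (2/5) (1/2) (31623/12500) (rpow_le_of_pow_le (k := 1) (n := 2) (by norm_num)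
      (by norm_num) (by norm_num) (by norm_num) (by norm_num)) h13.le h14 (by norm_num)
  rcases le_or_gt u (13/20) with h15 | h15
  · exact cell (1/2) (13/20) (33421/10000) (rpow_le_of_pow_le (k := 13) (n := 20) (by norm_num)
      (by norm_num) (by norm_num) (by norm_num) (by norm_num)) h14.le h15 (by norm_num)
  rcases le_or_gt u (47/50) with h16 | h16
  · exact cell (13/20) (47/50) (286273/50000) (rpow_le_of_pow_le (k := 47) (n := 50) (by norm_num)
      (by norm_num) (by norm_num) (by norm_num) (by norm_num)) h15.le h16 (by norm_num)
  · exact cell (47 / 50) 1 (32 / 5) (by rw [Real.rpow_one]) h16.le hu1.le (by norm_num)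

/-! ## Bessel allowance on `6 ≤ y ≤ 32/5` -/

/-- `48√y e^{−1.4πy} ≤ 2/1000` for `6 ≤ y ≤ 32/5` (indeed for `3 ≤ y ≤ 32/5`: `e^{−1.4πy} ≤ e^{−12} < 49⁻³`,
`√y ≤ 2.53`). [folklore] -/
private theorem smallK_bessel_allowance_R4 {y : ℝ} (hy1 : 6 ≤ y) (hy2 : y ≤ 32 / 5) :
    48 * Real.sqrt y * Real.exp (-(7 / 5) * Real.pi * y) ≤ 2 * (1 / 1000) := by
  have hπ := Real.pi_gt_three
  have he4 := exp_neg_four_lt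
  have he0 : 0 < Real.exp (-4) := Real.exp_pos _
  have hexp : Real.exp (-(7 / 5) * Real.pi * y) ≤ (1 / 49) ^ 3 := by
    have e12 : Real.exp (-12) = Real.exp (-4) ^ 3 := by
      rw [show (-12 : ℝ) = (3 : ℕ) * (-4) by norm_num, Real.exp_nat_mul]
    refine le_trans (Real.exp_le_exp.2 ?_) (e12.le.trans ?_)
    · nlinarith
    · exact pow_le_pow_left₀ he0.le he4.le 3
  have hs : Real.sqrt y ≤ 2.53 := by
    refine (Real.sqrt_le_sqrt hy2).trans ?_
    rw [Real.sqrt_le_left (by norm_num)]; norm_num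
  calc 48 * Real.sqrt y * Real.exp (-(7 / 5) * Real.pi * y) ≤ 48 * 2.53 * (1 / 49) ^ 3 :=
        mul_le_mul (mul_le_mul_of_nonneg_left hs (by norm_num)) hexp (Real.exp_pos _).le
          (by positivity)
    _ ≤ _ := by norm_num

/-! ## `6 ≤ y ≤ 32/5`: `Λ_z(σ) < 0` on `(½, 1)`, hence on `(0, 1)` -/

/-- **No real zeros in `(½, 1)` for `6 ≤ y = Im z ≤ 32/5`.** By the constant-term decomposition
`Λ_z(σ) = 2y^σΛ(2σ) + 2y^{1−σ}Λ(2−2σ) + E_z(σ)` (`Λ_eq_constantTerm_add_besselPart`), the bounds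
`Λ(1 + u) < 1/20 − 1/(1+u) + 1/u`, `Λ(1 − u) < 1/20 − 1/(1−u) − 1/u` (`u = 2σ − 1`),
`|E_z(σ)| ≤ 48√y e^{−1.4πy}` and `smallK_keyIneq_R4`. [cite: BatemanGrosswald1964, Theorem 3 (10)–(11)] -/
theorem re_thetaΛ_neg_of_six_le_im_of_half_lt (z : ℍ) (hy1 : 6 ≤ z.im) (hy2 : z.im ≤ 32 / 5) {σ : ℝ}
    (hσ : 1 / 2 < σ) (hσ1 : σ < 1) : ((thetaFEPair z).Λ σ).re < 0 := by
  set y := z.im with hydef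
  have hy0 : 0 < y := by linarith
  have hy1' : 1 ≤ y := by linarith
  have hσ0 : (0 : ℝ) < σ := by linarith
  set u : ℝ := 2 * σ - 1 with hu
  have hu0 : 0 < u := by rw [hu]; linarith
  have hu1 : u < 1 := by rw [hu]; linarith
  -- the decomposition at `s = σ`
  have h0 : (σ : ℂ) ≠ 0 := by exact_mod_cast hσ0.ne'
  have h1 : (σ : ℂ) ≠ 1 := by exact_mod_cast hσ1.ne
  have hh : (σ : ℂ) ≠ 1 / 2 := by
    intro h
    have := congrArg Complex.re h
    simp at this
    linarith
  have hdec := Λ_eq_constantTerm_add_besselPart z hy1' h0 h1 hh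
  -- real forms of the two constant terms
  have eA : (2 * ((y : ℝ) : ℂ) ^ (σ : ℂ) * completedRiemannZeta (2 * (σ : ℂ))).re =
      2 * y ^ σ * (completedRiemannZeta ((1 + u : ℝ) : ℂ)).re := by
    rw [show (2 : ℂ) * (σ : ℂ) = ((1 + u : ℝ) : ℂ) by rw [hu]; push_cast; ring,
      ← Complex.ofReal_cpow hy0.le,
      show (2 : ℂ) * ((y ^ σ : ℝ) : ℂ) = ((2 * y ^ σ : ℝ) : ℂ) by push_cast; ring,
      Complex.re_ofReal_mul]
  have eB : (2 * ((y : ℝ) : ℂ) ^ (1 - (σ : ℂ)) * completedRiemannZeta (2 - 2 * (σ : ℂ))).re =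
      2 * y ^ (1 - σ) * (completedRiemannZeta ((1 - u : ℝ) : ℂ)).re := by
    rw [show (2 : ℂ) - 2 * (σ : ℂ) = ((1 - u : ℝ) : ℂ) by rw [hu]; push_cast; ring,
      show (1 : ℂ) - (σ : ℂ) = ((1 - σ : ℝ) : ℂ) by push_cast; ring, ← Complex.ofReal_cpow hy0.le,
      show (2 : ℂ) * ((y ^ (1 - σ) : ℝ) : ℂ) = ((2 * y ^ (1 - σ) : ℝ) : ℂ) by push_cast; ring,
      Complex.re_ofReal_mul]
  -- the bounds
  have hP := re_completedRiemannZeta_one_add_lt hu0 hu1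
  have hN := re_completedRiemannZeta_one_sub_lt hu0 hu1
  have hyσ : 0 < y ^ σ := Real.rpow_pos_of_pos hy0 σ
  have hy1σ : 1 ≤ y ^ (1 - σ) := by
    calc (1 : ℝ) = y ^ (0 : ℝ) := (Real.rpow_zero y).symm
      _ ≤ y ^ (1 - σ) := Real.rpow_le_rpow_of_exponent_le hy1' (by linarith)
  have hy1σ0 : 0 < y ^ (1 - σ) := by linarith
  have hkey := smallK_keyIneq_R4 hy1 hy2 hu0 hu1
  have hE : (epsteinBesselPart z σ).re ≤ 2 * (1 / 1000) := by
    have hn := norm_epsteinBesselPart_le z hy1' (s := (σ : ℂ)) (by simp; linarith) (by simp; linarith)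
    have hb := smallK_bessel_allowance_R4 hy1 hy2
    exact ((Complex.re_le_norm _).trans hn).trans hb
  -- `y^σ = y^u · y^{1−σ}`
  have hsplit : y ^ σ = y ^ u * y ^ (1 - σ) := by
    rw [← Real.rpow_add hy0]; congr 1; rw [hu]; ring
  have hA : 2 * y ^ σ * (completedRiemannZeta ((1 + u : ℝ) : ℂ)).re ≤
      2 * y ^ σ * (1 / 20 - 1 / (1 + u) + 1 / u) :=
    mul_le_mul_of_nonneg_left hP.le (mul_pos two_pos hyσ).le
  have hB : 2 * y ^ (1 - σ) * (completedRiemannZeta ((1 - u : ℝ) : ℂ)).re <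
      2 * y ^ (1 - σ) * (1 / 20 - 1 / (1 - u) - 1 / u) :=
    mul_lt_mul_of_pos_left hN (mul_pos two_pos hy1σ0)
  -- `2 y^σ P + 2 y^{1−σ} Q + 2/1000 ≤ 0` from `hkey` multiplied by `y^{1−σ} ≥ 1`
  have hP0 : 0 ≤ y ^ u * (1 / 20 - 1 / (1 + u) + 1 / u) := by
    have : 0 ≤ 1 / 20 - 1 / (1 + u) + 1 / u := by
      rw [show 1 / 20 - 1 / (1 + u) + 1 / u = 1 / 20 + (1 / u - 1 / (1 + u)) by ring]
      have : 1 / (1 + u) ≤ 1 / u := one_div_le_one_div_of_le hu0 (by linarith)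
      linarith
    exact mul_nonneg (Real.rpow_pos_of_pos hy0 u).le this
  have hfin : 2 * y ^ σ * (1 / 20 - 1 / (1 + u) + 1 / u) +
      2 * y ^ (1 - σ) * (1 / 20 - 1 / (1 - u) - 1 / u) + 2 * (1 / 1000) ≤ 0 := by
    -- `T := y^u P + Q + 1/1000 ≤ 0` (this is `hkey`), and `y^{1−σ} T ≤ T`-type bound
    have hT : y ^ u * (1 / 20 - 1 / (1 + u) + 1 / u) + (1 / 20 - 1 / (1 - u) - 1 / u) + 1 / 1000 ≤ 0 := by
      linarith
    have h1 : y ^ (1 - σ) * (y ^ u * (1 / 20 - 1 / (1 + u) + 1 / u) + (1 / 20 - 1 / (1 - u) - 1 / u) + 1 / 1000)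
        ≤ y ^ u * (1 / 20 - 1 / (1 + u) + 1 / u) + (1 / 20 - 1 / (1 - u) - 1 / u) + 1 / 1000 := by
      -- `c ≥ 1`, `T ≤ 0` ⇒ `c T ≤ T`
      have := mul_le_mul_of_nonpos_right hy1σ hT
      linarith
    have h2 : 2 * y ^ σ * (1 / 20 - 1 / (1 + u) + 1 / u) +
        2 * y ^ (1 - σ) * (1 / 20 - 1 / (1 - u) - 1 / u) + 2 * (1 / 1000) =
        2 * (y ^ (1 - σ) * (y ^ u * (1 / 20 - 1 / (1 + u) + 1 / u) + (1 / 20 - 1 / (1 - u) - 1 / u)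
          + 1 / 1000)) + 2 * (1 / 1000) * (1 - y ^ (1 - σ)) := by
      rw [hsplit]; ring
    rw [h2]
    nlinarith
  rw [hdec, Complex.add_re, Complex.add_re, eA, eB]
  linarith

/-- **No real zeros in `(0, 1)` for `6 ≤ y = Im z ≤ 32/5`**: `Re Λ_z(σ) < 0` for every `0 < σ < 1`
(`(½, 1)` from `re_thetaΛ_neg_of_six_le_im_of_half_lt`, `(0, ½)` by `Λ_z(1 − s) = Λ_z(s)`, and
`σ = ½` is Bateman–Grosswald (11), `re_Λ_half_neg`, `y ≤ 32/5 ≤ 7.0554`).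
[cite: BatemanGrosswald1964, Theorem 3 (11)] -/
theorem re_thetaΛ_neg_of_six_le_im (z : ℍ) (hy1 : 6 ≤ z.im) (hy2 : z.im ≤ 32 / 5) {σ : ℝ}
    (hσ0 : 0 < σ) (hσ1 : σ < 1) : ((thetaFEPair z).Λ σ).re < 0 := by
  rcases lt_trichotomy σ (1 / 2) with h | h | h
  · -- `σ < ½`: reflect
    rw [← thetaFEPair_Λ_one_sub z (σ : ℂ), show (1 : ℂ) - (σ : ℂ) = ((1 - σ : ℝ) : ℂ) by push_cast; ring]
    exact re_thetaΛ_neg_of_six_le_im_of_half_lt z hy1 hy2 (by linarith) (by linarith)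
  · -- `σ = ½`
    rw [h]
    have h3 : Real.sqrt 3 / 2 ≤ z.im := by
      refine le_trans ?_ (show (1 : ℝ) ≤ z.im by linarith)
      rw [div_le_one two_pos, Real.sqrt_le_left (by norm_num)]; norm_num
    have := re_Λ_half_neg z h3 (by linarith)
    simpa using this
  · exact re_thetaΛ_neg_of_six_le_im_of_half_lt z hy1 hy2 h hσ1

/-- **No real zeros in `(0, 1)` for `4/5 ≤ y = Im z ≤ 32/5`** (the generation-8 range `y ≤ 6` of
`re_thetaΛ_neg_of_im_le_six` and the new strip `6 ≤ y ≤ 32/5`). [cite: BatemanGrosswald1964, Theorem 3 (10)–(11)] -/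
theorem re_thetaΛ_neg_of_im_le_thirtyTwo_fifths (z : ℍ) (hy45 : 4 / 5 ≤ z.im) (hy2 : z.im ≤ 32 / 5)
    {σ : ℝ} (hσ0 : 0 < σ) (hσ1 : σ < 1) : ((thetaFEPair z).Λ σ).re < 0 := by
  rcases le_or_gt z.im 6 with h | h
  · exact re_thetaΛ_neg_of_im_le_six z hy45 h hσ0 hσ1
  · exact re_thetaΛ_neg_of_six_le_im z h.le hy2 hσ0 hσ1

/-! ## Transfer to the Epstein zeta function of a form with `4/5 ≤ k ≤ 32/5` -/

variable {a b c : ℝ}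

/-- **`Re ζ_Q(σ) < 0` on all of `(0, 1)` when `4/5 ≤ k ≤ 32/5`** (`k = √|d|/(2a)`), for every analytic
continuation `Z` of `ζ_Q`. [cite: BatemanGrosswald1964, Theorem 3 (10)–(11)] -/
theorem re_neg_of_starkK_le_thirtyTwo_fifths (h : IsPosDefForm a b c) (hk1 : 4 / 5 ≤ starkK a b c)
    (hk2 : starkK a b c ≤ 32 / 5) {Z : ℂ → ℂ} (hZ : IsEpsteinContinuation a b c Z) {σ : ℝ}
    (hσ0 : 0 < σ) (hσ1 : σ < 1) : (Z σ).re < 0 := by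
  obtain ⟨z, hre, him, hk'⟩ := exists_zQ' h
  have hZ' : IsEpsteinContinuation c b a Z := (isEpsteinContinuation_swap_iff a b c Z).2 hZ
  rw [continuation_ofReal_eq h.swap z hre him hZ' hσ0 hσ1, Complex.re_ofReal_mul]
  refine mul_neg_of_pos_of_neg (realFactor_pos h.swap hσ0) ?_
  rw [← hk'] at hk1 hk2
  exact re_thetaΛ_neg_of_im_le_thirtyTwo_fifths z hk1 hk2 hσ0 hσ1

/-- **No real zeros in `(0, 1)` when `4/5 ≤ k ≤ 32/5`.** [cite: BatemanGrosswald1964, Theorem 3 (10)–(11)] -/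
theorem no_realZero_of_starkK_le_thirtyTwo_fifths (h : IsPosDefForm a b c) (hk1 : 4 / 5 ≤ starkK a b c)
    (hk2 : starkK a b c ≤ 32 / 5) {Z : ℂ → ℂ} (hZ : IsEpsteinContinuation a b c Z) {β : ℝ}
    (hβ0 : 0 < β) (hβ1 : β < 1) : Z β ≠ 0 := by
  intro h0
  have h := re_neg_of_starkK_le_thirtyTwo_fifths h hk1 hk2 hZ hβ0 hβ1
  rw [h0, Complex.zero_re] at h
  exact lt_irrefl _ h

/-! ## The class sum for `|d| ≤ 163` -/

section ClassSum

open Literature.NumberTheory.QuadraticFields.BinaryQuadraticForm (reducedForms mem_reducedForms_iff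
  le_of_isReduced discr_apply)
open Literature.NumberTheory.LFunctions (riemannZeta_im_eq_zero_of_pos riemannZeta_re_neg_of_pos_of_lt_one)

/-- **Every reduced class of a discriminant `−d` with `4 < d ≤ 163` has `4/5 ≤ k ≤ 32/5`**, hence its
Epstein zeta function is negative on all of `(0, 1)` (every continuation): `k = √d/(2a) ≤ √d/2 ≤ 6.4`
(`163 ≤ (32/5)² = 163.84`) and `3a² ≤ d` gives `k ≥ √3/2`. [cite: BatemanGrosswald1964, Theorem 3 (10)–(11)] -/
theorem re_neg_of_mem_reducedForms_of_le_onehundredsixtythree {d : ℕ} (hd : 4 < d) (hd' : d ≤ 163)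
    {a b c : ℤ} (hQ : (a, b, c) ∈ reducedForms (-(d : ℤ))) {Z : ℂ → ℂ}
    (hZ : IsEpsteinContinuation (a : ℝ) (b : ℝ) (c : ℝ) Z) {σ : ℝ}
    (hσ0 : 0 < σ) (hσ1 : σ < 1) : (Z σ).re < 0 := by
  have hD0 : (-(d : ℤ)) < 0 := by omega
  obtain ⟨hdisc, ha, -, hred⟩ := (mem_reducedForms_iff hD0).1 hQ
  obtain ⟨-, hb1, hb2, hac⟩ := le_of_isReduced hdisc ha hred
  simp only at ha
  rw [discr_apply] at hdisc
  have hbsq : b ^ 2 ≤ a ^ 2 := by nlinarith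
  have h3a : 3 * a ^ 2 ≤ (d : ℤ) := by nlinarith
  have haR : (1 : ℝ) ≤ a := by exact_mod_cast ha
  have hdR : (4 : ℝ) * a * c - (b : ℝ) ^ 2 = d := by
    exact_mod_cast (by linarith : 4 * a * c - b ^ 2 = (d : ℤ))
  have h3aR : 3 * (a : ℝ) ^ 2 ≤ d := by exact_mod_cast h3a
  have hd4R : (4 : ℝ) < d := by exact_mod_cast hd
  have hd163 : (d : ℝ) ≤ 163 := by exact_mod_cast hd'
  have hpos : IsPosDefForm (a : ℝ) (b : ℝ) (c : ℝ) := ⟨by linarith, by linarith⟩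
  have hk : starkK (a : ℝ) (b : ℝ) (c : ℝ) = Real.sqrt d / (2 * a) := by rw [starkK, hdR]
  have hsd : Real.sqrt d ≤ 64 / 5 := by
    rw [Real.sqrt_le_left (by norm_num)]; linarith
  -- `4/5 ≤ k`
  have hk45 : 4 / 5 ≤ starkK (a : ℝ) (b : ℝ) (c : ℝ) := by
    rw [hk, le_div_iff₀ (by positivity), Real.le_sqrt' (by positivity)]
    nlinarith
  -- `k ≤ 32/5`
  have hk2 : starkK (a : ℝ) (b : ℝ) (c : ℝ) ≤ 32 / 5 := by
    rw [hk, div_le_iff₀ (by positivity)]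
    nlinarith
  exact re_neg_of_starkK_le_thirtyTwo_fifths hpos hk45 hk2 hZ hσ0 hσ1

/-- **`Re L(σ, χ) > 0` on ALL of `(0, 1)`** for the odd real primitive character `χ` mod `d`,
`4 < d ≤ 163` — in particular for `d = 163`: `ζ(s)L(s, χ) = ½Σ_{Q reduced} Z_Q(s)` continued to
`ℂ ∖ {1}`, each class term negative on `(0, 1)` (`re_neg_of_mem_reducedForms_of_le_onehundredsixtythree`),
and `ζ(σ) < 0`. [cite: BatemanGrosswald1964, Theorem 3 (10)–(11)] -/
theorem LFunction_re_pos_of_odd_quadratic_of_le_onehundredsixtythree {d : ℕ} [NeZero d] (hd : 4 < d)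
    (hd' : d ≤ 163) {χ : DirichletCharacter ℂ d} (hprim : χ.IsPrimitive) (hquad : χ.IsQuadratic)
    (hodd : χ.Odd) {σ : ℝ} (hσ0 : 0 < σ) (hσ1 : σ < 1) : 0 < (χ.LFunction σ).re := by
  classical
  have hd4R : (4 : ℝ) < d := by exact_mod_cast hd
  have hχ1 : χ ≠ 1 := by
    intro h
    have h1 : χ (-1) = -1 := hodd
    rw [h, MulChar.one_apply (isUnit_one.neg)] at h1
    norm_num at h1
  set S := reducedForms (-(d : ℤ)) with hS
  -- continuations of the class zeta functions
  have hex : ∀ Q : ℤ × ℤ × ℤ, ∃ Z : ℂ → ℂ,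
      Q ∈ S → IsEpsteinContinuation (Q.1 : ℝ) (Q.2.1 : ℝ) (Q.2.2 : ℝ) Z := by
    intro Q
    by_cases hQ : Q ∈ S
    · have hD0 : (-(d : ℤ)) < 0 := by omega
      obtain ⟨hdisc, ha, -, hred⟩ := (mem_reducedForms_iff hD0).1 hQ
      obtain ⟨-, hb1, hb2, hac⟩ := le_of_isReduced (a := Q.1) (b := Q.2.1) (c := Q.2.2) hdisc ha hred
      rw [show Q = (Q.1, Q.2.1, Q.2.2) from rfl, discr_apply] at hdisc
      have hpos : IsPosDefForm (Q.1 : ℝ) (Q.2.1 : ℝ) (Q.2.2 : ℝ) := by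
        refine ⟨by exact_mod_cast ha, ?_⟩
        have : (Q.2.1 : ℝ) ^ 2 - 4 * (Q.1 : ℝ) * (Q.2.2 : ℝ) = ((-(d : ℤ) : ℤ) : ℝ) := by
          exact_mod_cast hdisc
        rw [this]; push_cast; linarith
      obtain ⟨Z, hZ, -⟩ := MontgomeryVaughan2007_epsteinContinuation_holds _ _ _ hpos
      exact ⟨Z, fun _ => hZ⟩
    · exact ⟨0, fun h => absurd h hQ⟩
  choose Z hZ using hex
  set G : ℂ → ℂ := fun s => 1 / 2 * ∑ Q ∈ S, Z Q s with hGdef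
  set F : ℂ → ℂ := fun s => riemannZeta s * χ.LFunction s with hFdef
  -- both sides are analytic on `ℂ ∖ {1}` and agree on `Re s > 1`
  have hU : IsOpen {s : ℂ | s ≠ 1} := isOpen_ne
  have hFd : DifferentiableOn ℂ F {s : ℂ | s ≠ 1} := fun s hs =>
    ((differentiableAt_riemannZeta hs).mul
      ((DirichletCharacter.differentiable_LFunction hχ1) s)).differentiableWithinAt
  have hGd : DifferentiableOn ℂ G {s : ℂ | s ≠ 1} :=
    (differentiableOn_const _).mul (DifferentiableOn.fun_sum fun Q hQ => (hZ Q hQ).1)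
  have hFG : EqOn F G {s : ℂ | s ≠ 1} := by
    refine (hFd.analyticOnNhd hU).eqOn_of_preconnected_of_eventuallyEq (hGd.analyticOnNhd hU)
      isPreconnected_compl_one (show (2 : ℂ) ∈ {s : ℂ | s ≠ 1} by norm_num) ?_
    have hopen : IsOpen {s : ℂ | 1 < s.re} := isOpen_lt continuous_const Complex.continuous_re
    filter_upwards [hopen.mem_nhds (show (2 : ℂ) ∈ {s : ℂ | 1 < s.re} by simp)] with s hs
    have hs' : 1 < s.re := hs
    simp only [hFdef, hGdef]
    rw [riemannZeta_mul_LFunction_eq_half_sum_of_one_lt_re hd hprim hquad hodd hs']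
    congr 1
    exact Finset.sum_congr rfl fun Q hQ => ((hZ Q hQ).2 s hs').symm
  -- the class sum is non-empty (else `ζ(2)L(2, χ) = 0`)
  have hne : S.Nonempty := by
    by_contra hS0
    rw [Finset.not_nonempty_iff_eq_empty] at hS0
    have h2 := hFG (show (2 : ℂ) ∈ {s : ℂ | s ≠ 1} by norm_num)
    simp only [hFdef, hGdef, hS0, Finset.sum_empty, mul_zero] at h2
    exact mul_ne_zero (riemannZeta_ne_zero_of_one_lt_re (by norm_num))
      (χ.LFunction_ne_zero_of_one_le_re (Or.inl hχ1) (by norm_num)) h2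
  -- at the real point `σ`
  have hσU : ((σ : ℂ)) ∈ {s : ℂ | s ≠ 1} := by
    simp only [Set.mem_setOf_eq]
    exact_mod_cast hσ1.ne
  have heq := hFG hσU
  simp only [hFdef, hGdef] at heq
  have hGneg : (1 / 2 * ∑ Q ∈ S, Z Q σ).re < 0 := by
    rw [show (1 : ℂ) / 2 = ((1 / 2 : ℝ) : ℂ) by push_cast; ring, Complex.re_ofReal_mul, Complex.re_sum]
    have hlt : ∑ Q ∈ S, (Z Q σ).re < ∑ _Q ∈ S, (0 : ℝ) :=
      Finset.sum_lt_sum_of_nonempty hne fun Q hQ =>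
        re_neg_of_mem_reducedForms_of_le_onehundredsixtythree hd hd' (a := Q.1) (b := Q.2.1)
          (c := Q.2.2) hQ (hZ Q hQ) hσ0 hσ1
    rw [Finset.sum_const_zero] at hlt
    linarith
  rw [← heq, Complex.mul_re, riemannZeta_im_eq_zero_of_pos hσ0 hσ1.ne, zero_mul, sub_zero] at hGneg
  exact pos_of_mul_neg_right hGneg (riemannZeta_re_neg_of_pos_of_lt_one hσ0 hσ1).le

/-- **No real zero of `L(s, χ)` in `(0, 1)` for every odd real primitive character of conductor
`4 < d ≤ 163`** — in particular none for `χ₋₁₆₃` (class number one, the extremal small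
discriminant): kernel-checked, by the Epstein class sum alone. [cite: BatemanGrosswald1964, Theorem 3 (10)–(11)] -/
theorem LFunction_ne_zero_of_odd_quadratic_of_le_onehundredsixtythree {d : ℕ} [NeZero d] (hd : 4 < d)
    (hd' : d ≤ 163) {χ : DirichletCharacter ℂ d} (hprim : χ.IsPrimitive) (hquad : χ.IsQuadratic)
    (hodd : χ.Odd) {σ : ℝ} (hσ0 : 0 < σ) (hσ1 : σ < 1) : χ.LFunction σ ≠ 0 := by
  intro h0
  have h := LFunction_re_pos_of_odd_quadratic_of_le_onehundredsixtythree hd hd' hprim hquad hodd hσ0 hσ1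
  rw [h0, Complex.zero_re] at h
  exact lt_irrefl _ h

end ClassSum

end Literature.Barriers.RiemannHypothesis

end
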